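import Literature.Geometry.Lorentzian.KerrSchildMultiplierEnergyIdentity
import HarnessLib

/-!
# Energy identities between graph hypersurfaces reaching null infinity: the smeared future
# time cut-off, currents of local regularity, slicing of the layer term, and removal of the
# cut-off by monotone convergence

(family `gr`; infrastructure for the far-region (`r^p`-weighted, Morawetz and `T`-energy) estimates
behind statement **gr.S24** — Dafermos–Rodnianski–Shlapentokh-Rothman, arXiv:1402.7034 = Ann. of
Math. 183 (2016), §2.3.2 and §3.3 (Cor. 3.1 via the `r^p` method of arXiv:0910.4957), in the
coefficient-field framework of `KerrSchild.waveOperator`; namespaces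
`Literature.Geometry.Lorentzian.E4`, `Literature.Geometry.Lorentzian.KerrSchild`)

The divergence identities of `KerrSchildGraphDivergence.lean` and
`KerrSchildMultiplierEnergyIdentity.lean` (DRSR §2.3.2, (ingeneralform)) apply between two graph
hypersurfaces `{t = τ + F₁(y)}`, `{t = τ + F₂(y)}` of the ingoing Kerr–Schild chart to currents
which **vanish on the far part of the wedge** between them — the situation of the boundedness and
integrated-decay statements, where the hypersurfaces are asymptotically flat and the wave has
compact support on each of them. The `r^p`-weighted energy estimates of Dafermos–Rodnianski
(arXiv:0910.4957, §3: the region `𝓓^{τ₂}_{τ₁}` bounded by two outgoing null (or hyperboloidal)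
leaves, the cylinder `{r = R}` *and a piece of future null infinity `𝓘⁺`*, which carries the
boundary term `∫_{𝓘⁺} r^p |∇̸ψ|²`) and their extension by Moschidis (arXiv:1509.08489, Thm. 5.1 and
Lemmas 4.1, 4.5: the regions `𝓡(τ₁, τ₂) ∩ {t ≤ T*}` between two hyperboloids `{t̄ = τᵢ}` terminating
at `𝓘⁺`, cut off by the slice `{t = T*}`, with `lim sup_{T* → +∞}` of the resulting terms on
`{t = T*}`) live instead on wedges between **hyperboloidal** leaves, along which the solution does
not vanish far out (radiation reaches `𝓘⁺` along every such leaf): the wedge is non-compact and the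
currents are merely of spatially compact support *below each time level* (finite speed of
propagation from compactly supported data on a Kerr–Schild slice).

This file supplies the corresponding form of the divergence identity. As in
`KerrSchildCutoffCurrent.lean`, where the inner (horizon) boundary is replaced by a cut-off layer,
the future boundary `{t = T}` is **smeared**: the current `J` is replaced by `ζ(T − t) J` for a
`C¹` profile `ζ` vanishing on `(−∞, 0]` (so `ζ(T − t) = 0` for `t ≥ T`), which *does* vanish on
the far part of the wedge, and the would-be flux through `{t = T}` becomes the layer term
`−ζ'(T − t) J⁰` in the divergence `∑_μ ∂_μ(ζ(T − t) J^μ) = ζ(T − t) ∑_μ ∂_μ J^μ − ζ'(T − t) J⁰`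
(`E4.sum_fderiv_timeCutoff_mul`). No boundary integral over a piece of a slice, and no divergence
theorem for domains of `E3`, is needed.

* `E4.graphFlux_sub_eq_integral_integral_timeCutoff` — for a `C¹` current `J` on `ℝ⁴` vanishing at
  the points of the closed wedge with `‖y‖ > ρ` *and `t < T`*, two `C²` heights `F₁ ≤ F₂`:
  `∫ ζ(T − τ − F₂) ∑_μ J^μ n^{F₂}_μ dy − ∫ ζ(T − τ − F₁) ∑_μ J^μ n^{F₁}_μ dy
     = ∫ ∫_{(τ + F₁(y), τ + F₂(y)]} (ζ(T − t) ∑_μ ∂_μJ^μ − ζ'(T − t) J⁰)(t, y) dt dy`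
  (from `E4.graphFlux_sub_eq_integral_integral` for the current `ζ(T − t) J`), and the version
  `E4.graphFlux_translate_sub_eq_integral_integral_timeCutoff` for two leaves `Σ_τ`, `Σ_{τ+h}` of a
  graph foliation;
* `E4.contDiff_mul_of_tsupport_subset`, `E4.fderiv_mul_of_tsupport_subset` — a `C¹` cut-off `f`
  times a function which is `C¹` near `tsupport f` is `C¹` on all of `ℝ⁴`, with the product rule
  valid at every point: the device by which currents built from a wave `ψ` on the Kerr exterior
  (smooth only on `{r > r₊}`, the coefficients `g^{μν}_{M,a}` only on `{r > 0}`) and a cut-off to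
  the far region become global `C¹` currents on `ℝ⁴`;
* `KerrSchild.contDiffAt_multiplierCurrent`, `KerrSchild.contDiffAt_lagrangianCurrent` — pointwise
  regularity of the currents `J^X`, `L_ϖ` of `KerrSchildMultiplierCurrent.lean`;
* `KerrSchild.cutoffModifiedCurrent_graph_identity_timeCutoff` — **the energy identity for the
  cut-off modified current `f (J^X + ¼ L_ϖ)` between two leaves `{t = τ + F}`, `{t = τ + h + F}`
  with a smeared future time cut-off, under local regularity**: `G` (`C¹`, symmetric), `X` (`C¹`),
  `ϖ`, `w` (`C²`) only near `tsupport f`; `f ∈ C¹(ℝ⁴)`; and `f = 0` or `(w, dw) = 0` at the far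
  points of the wedge below time `T`. The space-time integrand is
  `ζ(T − t) ( f ((X(w) + ¼ϖw) □_G w + K^X + ¼ϖQ − ⅛(□_G ϖ)w²) + ∑_μ (J^X + ¼L)^μ ∂_μ f )
   − ζ'(T − t) f (J^X + ¼L)⁰`
  (DRSR §2.3.1–§2.3.2: bulk `K^{X,ϖ}`, source `𝓔^{X,ϖ}`, cut-off errors, and the smeared flux
  through `{t = T}`);
* `E4.integral_integral_Ioc_eq_integral_setIntegral` — **slicing** (Fubini): for a continuous
  integrand supported, within the wedge `{a(y) < t ≤ b(y)}`, in a bounded set,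
  `∫ ∫_{(a(y), b(y)]} Φ(t, y) dt dy = ∫ ∫_{{y : a(y) < t ≤ b(y)}} Φ(t, y) dy dt` — the form in
  which the layer term `∫∫ ζ'(T − t)(−J⁰)` is an average over `t ∈ [T − 1, T]` of energies through
  the pieces `{t} × {y : τ + F₁(y) < t ≤ τ + F₂(y)}` of the slices, to which slice-wise estimates
  (dominant energy condition, Hardy inequalities on the slice) apply, as for the terms on
  `{t = T*}` of Moschidis, loc. cit.;
* `E4.tendsto_lintegral_timeCutoff` — **removal of the cut-off** (monotone convergence): for `ζ`
  non-decreasing, `≤ 1`, and `= 1` on `[1, ∞)`, a measurable "time" `θ` and a non-negative density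
  `e` on any measure space, `∫⁻ ζ(T − θ(x)) e(x) dμ → ∫⁻ e dμ` as `T → ∞` (applied to leaves,
  `θ(y) = τ + F(y)`, and to space-time bulk terms): the passage `T* → +∞` of Moschidis, loc. cit.,
  and the definition of the `𝓘⁺`-terms as limits of terms on `{v = v₀}` / `{t = T}` in
  arXiv:0910.4957, §3.

All statements are about `C¹` currents on `ℝ⁴` with the coordinate divergence and the flux
`∑_μ J^μ n_μ dy` through graphs, `n = dt − dF` (`Kerr.graphConormal`), exactly as in
`KerrSchildGraphDivergence.lean`; for the energy currents `(J^X)^μ = T^μ{}_ν X^ν` the *energy* is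
`−∑_μ (J^X)^μ n_μ` (`KerrSchildMultiplierDEC.lean`). No definitions, no named facts (D-0026).
Not here: any sign or coercivity statement (which current, which leaf), and the Kerr-specific
identification of the leaf fluxes `Kerr.leafFlux` with these coordinate fluxes.

## References

* M. Dafermos, I. Rodnianski, Y. Shlapentokh-Rothman, *Decay for solutions of the wave equation on
  Kerr exterior spacetimes III: the full subextremal case `|a| < M`*, Ann. of Math. 183 (2016),
  arXiv:1402.7034, §2.3.1–§2.3.2 ((ingeneralform), cut-offs: Remark 2.3.1), §3.3 (hyperboloidal
  hypersurfaces, Cor. 3.1) (key `DafermosRodnianskiShlapentokhrothman2014`).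
* M. Dafermos, I. Rodnianski, *A new physical-space approach to decay for the wave equation with
  applications to black hole spacetimes*, XVIth ICMP (2010), arXiv:0910.4957, §3 (the region
  `𝓓^{τ₂}_{τ₁}` and its boundary piece on `𝓘⁺`) (key `DafermosRodnianski2010ICMP`).
* G. Moschidis, *The `r^p`-weighted energy method of Dafermos and Rodnianski in general
  asymptotically flat spacetimes and applications*, Ann. PDE 2 (2016), arXiv:1509.08489, §4
  (Lemmas 4.1, 4.5: regions `𝓡(τ₁, τ₂) ∩ {t ≤ T*}`), §5 (Thm. 5.1: `lim sup_{T* → +∞}`)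
  (key `Moschidis2016`).
* M. Dafermos, I. Rodnianski, *Lectures on black holes and linear waves*, arXiv:0811.0354, App. D
  (the divergence theorem for `J^V`) (key `DafermosRodnianski2008`).
-/

noncomputable section

open Set Filter
open scoped ContDiff Topology ENNReal

namespace Literature.Geometry.Lorentzian

open _root_.MeasureTheory Metric

namespace E4

/-! ### The smeared time cut-off `x ↦ ζ(T − x⁰)` -/

/-- The time cut-off `x ↦ ζ(T − x⁰)` is differentiable where `ζ` is, with differential
`−ζ'(T − x⁰) dx⁰`. [folklore] -/
theorem hasFDerivAt_timeCutoff {ζ : ℝ → ℝ} {T : ℝ} {x : E4}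
    (hζ : DifferentiableAt ℝ ζ (T - x 0)) :
    HasFDerivAt (fun x : E4 ↦ ζ (T - x 0)) ((-deriv ζ (T - x 0)) • (E4.dx 0 : E4 →L[ℝ] ℝ)) x := by
  have h0 : HasFDerivAt (fun x : E4 ↦ T - x 0) (-(E4.dx 0 : E4 →L[ℝ] ℝ)) x := by
    have := ((E4.dx 0).hasFDerivAt (x := x)).const_sub T
    simpa using this
  have h : HasFDerivAt (fun x : E4 ↦ ζ (T - x 0)) (deriv ζ (T - x 0) • -(E4.dx 0 : E4 →L[ℝ] ℝ)) x :=
    hζ.hasDerivAt.comp_hasFDerivAt x h0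
  refine h.congr_fderiv ?_
  ext v
  simp

/-- Coordinate derivatives of the time cut-off: `∂_μ [ζ(T − x⁰)] = −ζ'(T − x⁰) δ_{μ0}`.
[folklore] -/
theorem fderiv_timeCutoff_apply {ζ : ℝ → ℝ} {T : ℝ} {x : E4}
    (hζ : DifferentiableAt ℝ ζ (T - x 0)) (μ : Fin 4) :
    fderiv ℝ (fun x : E4 ↦ ζ (T - x 0)) x (E4.basisVector μ) =
      if μ = 0 then -deriv ζ (T - x 0) else 0 := by
  rw [(hasFDerivAt_timeCutoff hζ).fderiv, smul_apply, Kerr.dx_basisVector, smul_eq_mul]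
  by_cases hμ : μ = 0
  · subst hμ; simp
  · simp [hμ, Ne.symm hμ]

/-- The time cut-off `x ↦ ζ(T − x⁰)` is as smooth as `ζ`. [folklore] -/
theorem contDiff_timeCutoff {ζ : ℝ → ℝ} {n : WithTop ℕ∞} (hζ : ContDiff ℝ n ζ) (T : ℝ) :
    ContDiff ℝ n (fun x : E4 ↦ ζ (T - x 0)) :=
  hζ.comp (contDiff_const.sub (E4.dx 0).contDiff)

/-- **The divergence of a current with a smeared time cut-off**: for `J` differentiable at `x` and
`ζ` differentiable at `T − x⁰`,
`∑_μ ∂_μ (ζ(T − x⁰) J^μ)(x) = ζ(T − x⁰) ∑_μ ∂_μ J^μ(x) − ζ'(T − x⁰) J⁰(x)`: the layer term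
`−ζ'(T − t) J⁰` is the smeared flux of `J` through the slices `{t = const}` near `{t = T}`
(cf. the cut-off layer replacing the horizon boundary in `KerrSchildCutoffCurrent.lean`; DRSR
arXiv:1402.7034, Remark 2.3.1). [cite: DafermosRodnianskiShlapentokhrothman2014, §2.3.2 Remark 2.3.1] -/
theorem sum_fderiv_timeCutoff_mul {J : Fin 4 → E4 → ℝ} {ζ : ℝ → ℝ} {T : ℝ} {x : E4}
    (hζ : DifferentiableAt ℝ ζ (T - x 0)) (hJ : ∀ μ, DifferentiableAt ℝ (J μ) x) :
    ∑ μ, fderiv ℝ (fun y ↦ ζ (T - y 0) * J μ y) x (E4.basisVector μ) =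
      ζ (T - x 0) * ∑ μ, fderiv ℝ (J μ) x (E4.basisVector μ) - deriv ζ (T - x 0) * J 0 x := by
  have hz : DifferentiableAt ℝ (fun y : E4 ↦ ζ (T - y 0)) x :=
    (hasFDerivAt_timeCutoff hζ).differentiableAt
  have hterm : ∀ μ, fderiv ℝ (fun y ↦ ζ (T - y 0) * J μ y) x (E4.basisVector μ) =
      ζ (T - x 0) * fderiv ℝ (J μ) x (E4.basisVector μ) +
        (if μ = 0 then -deriv ζ (T - x 0) else 0) * J μ x := by
    intro μ
    rw [fderiv_fun_mul hz (hJ μ)]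
    simp only [add_apply, smul_apply, smul_eq_mul, fderiv_timeCutoff_apply hζ]
    ring
  simp only [hterm, Finset.sum_add_distrib, ← Finset.mul_sum]
  simp [Fin.sum_univ_four]
  ring

/-! ### The divergence identity between two graphs with a smeared future time cut-off -/

/-- **The integrated divergence identity between two graph hypersurfaces with a smeared future
time cut-off.** Let `J = (J^μ)` be a `C¹` current on `ℝ⁴`, `ζ ∈ C¹(ℝ)` with `ζ = 0` on `(−∞, 0]`,
`F₁ ≤ F₂` two `C²` heights, `τ, T ∈ ℝ`, and assume that `J` vanishes at every point `(t, y)` of the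
closed wedge `τ + F₁(y) ≤ t ≤ τ + F₂(y)` with `‖y‖ > ρ` **and `t < T`** (spatially compact support
below the time level `T`; nothing is assumed about the far part of the wedge above `T`). Then, with
`n^F = dt − dF` (`Kerr.graphConormal`),
`∫ ζ(T − τ − F₂(y)) ∑_μ J^μ(τ + F₂(y), y) n^{F₂}_μ dy − ∫ ζ(T − τ − F₁(y)) ∑_μ J^μ(τ + F₁(y), y) n^{F₁}_μ dy
  = ∫ ∫_{(τ + F₁(y), τ + F₂(y)]} ( ζ(T − t) (∑_μ ∂_μ J^μ)(t, y) − ζ'(T − t) J⁰(t, y) ) dt dy`.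
This is `E4.graphFlux_sub_eq_integral_integral` for the current `ζ(T − t) J`, which vanishes on
the whole far part of the wedge (for `t ≥ T` through `ζ`), with its divergence
`E4.sum_fderiv_timeCutoff_mul`; it is the form of DRSR's (ingeneralform) (arXiv:1402.7034, §2.3.2)
on the regions `𝓡(τ₁, τ₂) ∩ {t ≤ T*}` of Moschidis (arXiv:1509.08489, §4–§5) with the boundary
piece on `{t = T*}` smeared into the layer `T − 1 ≤ t ≤ T`.
[cite: Moschidis2016, §5 Thm. 5.1 (regions 𝓡(τ₁,τ₂) ∩ {t ≤ T*}); DafermosRodnianskiShlapentokhrothman2014 §2.3.2] -/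
theorem graphFlux_sub_eq_integral_integral_timeCutoff {J : Fin 4 → E4 → ℝ}
    (hJ1 : ∀ μ, ContDiff ℝ 1 (J μ)) {ζ : ℝ → ℝ} (hζ : ContDiff ℝ 1 ζ)
    (hζ0 : ∀ s ≤ 0, ζ s = 0) {F₁ F₂ : E3 → ℝ} (hF₁ : ContDiff ℝ 2 F₁)
    (hF₂ : ContDiff ℝ 2 F₂) (hle : ∀ y, F₁ y ≤ F₂ y) {τ T ρ : ℝ}
    (hJ0 : ∀ μ (x : E4), ρ < E4.spatialNorm x → τ + F₁ (E4.spatial x) ≤ x 0 →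
      x 0 ≤ τ + F₂ (E4.spatial x) → x 0 < T → J μ x = 0) :
    (∫ y, ζ (T - (τ + F₂ y)) *
        ∑ μ, J μ (E4.ofTimeSpace (τ + F₂ y) y) * Kerr.graphConormal F₂ y μ) -
        ∫ y, ζ (T - (τ + F₁ y)) *
          ∑ μ, J μ (E4.ofTimeSpace (τ + F₁ y) y) * Kerr.graphConormal F₁ y μ =
      ∫ y, ∫ t in Set.Ioc (τ + F₁ y) (τ + F₂ y),
        (ζ (T - t) * ∑ μ, fderiv ℝ (J μ) (E4.ofTimeSpace t y) (E4.basisVector μ) -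
          deriv ζ (T - t) * J 0 (E4.ofTimeSpace t y)) := by
  have hJ1' : ∀ μ, ContDiff ℝ 1 fun x : E4 ↦ ζ (T - x 0) * J μ x := fun μ ↦
    (contDiff_timeCutoff hζ T).mul (hJ1 μ)
  have hJ0' : ∀ μ (x : E4), ρ < E4.spatialNorm x → τ + F₁ (E4.spatial x) ≤ x 0 →
      x 0 ≤ τ + F₂ (E4.spatial x) → ζ (T - x 0) * J μ x = 0 := by
    intro μ x hx h1 h2
    rcases lt_or_ge (x 0) T with hT | hT
    · rw [hJ0 μ x hx h1 h2 hT, mul_zero]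
    · rw [hζ0 _ (by linarith), zero_mul]
  have h := graphFlux_sub_eq_integral_integral (J := fun μ x ↦ ζ (T - x 0) * J μ x) hJ1' hF₁ hF₂
    hle (τ := τ) (ρ := ρ) hJ0'
  have hflux : ∀ (F : E3 → ℝ) (y : E3) (t : ℝ),
      ∑ μ, ζ (T - E4.ofTimeSpace t y 0) * J μ (E4.ofTimeSpace t y) * Kerr.graphConormal F y μ =
        ζ (T - t) * ∑ μ, J μ (E4.ofTimeSpace t y) * Kerr.graphConormal F y μ := by
    intro F y t
    rw [Finset.mul_sum]
    exact Finset.sum_congr rfl fun μ _ ↦ by rw [E4.ofTimeSpace_apply_zero]; ring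
  simp only [hflux] at h
  rw [h]
  refine congrArg (fun f : E3 → ℝ ↦ ∫ y, f y) (funext fun y ↦ ?_)
  refine setIntegral_congr_fun measurableSet_Ioc fun t _ ↦ ?_
  have hz : DifferentiableAt ℝ ζ (T - E4.ofTimeSpace t y 0) :=
    (hζ.differentiable one_ne_zero).differentiableAt
  rw [sum_fderiv_timeCutoff_mul hz fun μ ↦ ((hJ1 μ).differentiable one_ne_zero).differentiableAt]
  simp only [E4.ofTimeSpace_apply_zero]

/-- **The divergence identity between two leaves of a graph foliation with a smeared future time
cut-off**: the case `F₁ = F`, `F₂ = h + F` (`h ≥ 0`) of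
`graphFlux_sub_eq_integral_integral_timeCutoff` — the leaves `Σ_τ = {t = τ + F}` and `Σ_{τ+h}` of
a `φ_τ`-invariant graph foliation (DRSR arXiv:1402.7034, §2.3.2, (ingeneralform2); for
hyperboloidal `F` the region between them reaches `𝓘⁺`, Moschidis arXiv:1509.08489, §3.1, and the
current need only vanish far out *below the time level `T`*).
[cite: Moschidis2016, §5 Thm. 5.1 (regions 𝓡(τ₁,τ₂) ∩ {t ≤ T*}); DafermosRodnianskiShlapentokhrothman2014 §2.3.2] -/
theorem graphFlux_translate_sub_eq_integral_integral_timeCutoff {J : Fin 4 → E4 → ℝ}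
    (hJ1 : ∀ μ, ContDiff ℝ 1 (J μ)) {ζ : ℝ → ℝ} (hζ : ContDiff ℝ 1 ζ)
    (hζ0 : ∀ s ≤ 0, ζ s = 0) {F : E3 → ℝ} (hF : ContDiff ℝ 2 F) {τ h T ρ : ℝ} (hh : 0 ≤ h)
    (hJ0 : ∀ μ (x : E4), ρ < E4.spatialNorm x → τ + F (E4.spatial x) ≤ x 0 →
      x 0 ≤ τ + h + F (E4.spatial x) → x 0 < T → J μ x = 0) :
    (∫ y, ζ (T - (τ + h + F y)) *
        ∑ μ, J μ (E4.ofTimeSpace (τ + h + F y) y) * Kerr.graphConormal F y μ) -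
        ∫ y, ζ (T - (τ + F y)) *
          ∑ μ, J μ (E4.ofTimeSpace (τ + F y) y) * Kerr.graphConormal F y μ =
      ∫ y, ∫ t in Set.Ioc (τ + F y) (τ + h + F y),
        (ζ (T - t) * ∑ μ, fderiv ℝ (J μ) (E4.ofTimeSpace t y) (E4.basisVector μ) -
          deriv ζ (T - t) * J 0 (E4.ofTimeSpace t y)) := by
  have hF₂ : ContDiff ℝ 2 fun y ↦ h + F y := contDiff_const.add hF
  have h2 := graphFlux_sub_eq_integral_integral_timeCutoff hJ1 hζ hζ0 hF hF₂
    (fun y ↦ by linarith) (τ := τ) (T := T) (ρ := ρ)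
    fun μ x hx h1 h2 hT ↦ hJ0 μ x hx h1 (by simpa [add_assoc] using h2) hT
  have hn : ∀ (y : E3) (μ : Fin 4),
      Kerr.graphConormal (fun y ↦ h + F y) y μ = Kerr.graphConormal F y μ := by
    intro y μ
    refine Fin.cases rfl (fun i ↦ ?_) μ
    simp only [Kerr.graphConormal_succ, Kerr.partialE3, fderiv_const_add]
  simp only [hn, ← add_assoc] at h2
  exact h2

/-! ### Currents of local regularity: a cut-off times a function smooth near its support -/

/-- **A `C¹` cut-off times a function which is `C¹` near the support of the cut-off is `C¹` on all
of `ℝ⁴`** (near a point of `U` it is a product of `C¹` functions, near a point outside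
`tsupport f ⊆ U` it vanishes identically). This is how a current built from a wave which is smooth
only on the Kerr exterior `{r > r₊} ⊆ ℝ⁴`, cut off to the far region, becomes a global `C¹` current.
[folklore] -/
theorem contDiff_mul_of_tsupport_subset {f g : E4 → ℝ} {U : Set E4}
    (hfU : tsupport f ⊆ U) (hf : ContDiff ℝ 1 f) (hg : ∀ x ∈ U, ContDiffAt ℝ 1 g x) :
    ContDiff ℝ 1 fun x ↦ f x * g x := by
  refine contDiff_iff_contDiffAt.2 fun x ↦ ?_
  by_cases hx : x ∈ U
  · exact hf.contDiffAt.mul (hg x hx)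
  · have hx' : x ∉ tsupport f := fun h ↦ hx (hfU h)
    have hev : (fun y ↦ f y * g y) =ᶠ[𝓝 x] fun _ ↦ 0 := by
      filter_upwards [notMem_tsupport_iff_eventuallyEq.mp hx'] with y hy
      simp [hy]
    exact (contDiffAt_const (c := (0 : ℝ))).congr_of_eventuallyEq hev

/-- **The product rule for a `C¹` cut-off times a function differentiable near its support, at
every point of `ℝ⁴`**: `∂_v(f g)(x) = f(x) ∂_v g(x) + g(x) ∂_v f(x)` — at points of `U` by the
product rule, at points outside `tsupport f ⊆ U` because all three terms vanish. [folklore] -/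
theorem fderiv_mul_of_tsupport_subset {f g : E4 → ℝ} {U : Set E4}
    (hfU : tsupport f ⊆ U) (hf : ContDiff ℝ 1 f) (hg : ∀ x ∈ U, DifferentiableAt ℝ g x)
    (x : E4) (v : E4) :
    fderiv ℝ (fun y ↦ f y * g y) x v = f x * fderiv ℝ g x v + g x * fderiv ℝ f x v := by
  by_cases hx : x ∈ U
  · rw [fderiv_fun_mul (hf.differentiable one_ne_zero x) (hg x hx)]
    simp only [add_apply, smul_apply, smul_eq_mul, mul_comm (f x)]
  · have hx' : x ∉ tsupport f := fun h ↦ hx (hfU h)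
    have hev : (fun y ↦ f y * g y) =ᶠ[𝓝 x] fun _ ↦ 0 := by
      filter_upwards [notMem_tsupport_iff_eventuallyEq.mp hx'] with y hy
      simp [hy]
    rw [hev.fderiv_eq, fderiv_of_notMem_tsupport ℝ hx', image_eq_zero_of_notMem_tsupport hx']
    simp only [fderiv_fun_const, Pi.zero_apply, zero_apply, mul_zero,
      zero_mul, add_zero]

end E4

namespace KerrSchild

/-! ### Pointwise regularity of the currents -/

/-- **The multiplier current is `C¹` at a point** where the coefficients and the multiplier are `C¹`
and the function is `C²` (pointwise form of `KerrSchild.contDiff_multiplierCurrent`). [folklore] -/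
theorem contDiffAt_multiplierCurrent {G : E4 → Fin 4 → Fin 4 → ℝ} {X : E4 → Fin 4 → ℝ}
    {w : E4 → ℝ} {x : E4} (hG : ∀ μ ν, ContDiffAt ℝ 1 (fun y ↦ G y μ ν) x)
    (hX : ∀ α, ContDiffAt ℝ 1 (fun y ↦ X y α) x) (hw : ContDiffAt ℝ 2 w x) (μ : Fin 4) :
    ContDiffAt ℝ 1 (fun y ↦ multiplierCurrent G X w y μ) x := by
  have hp : ∀ κ, ContDiffAt ℝ 1 (fun y ↦ fderiv ℝ w y (E4.basisVector κ)) x := fun κ ↦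
    (hw.fderiv_right (m := 1) le_rfl).clm_apply contDiffAt_const
  unfold multiplierCurrent
  exact ((ContDiffAt.sum fun ν _ ↦ (hG μ ν).mul (hp ν)).mul
    (ContDiffAt.sum fun α _ ↦ (hX α).mul (hp α))).sub
      ((contDiffAt_const.mul (hX μ)).mul
        (ContDiffAt.sum fun α _ ↦ ContDiffAt.sum fun β _ ↦ ((hG α β).mul (hp α)).mul (hp β)))

/-- **The Lagrangian current is `C¹` at a point** where the coefficients are `C¹` and the weight and
the function are `C²` (pointwise form of `KerrSchild.contDiff_lagrangianCurrent`). [folklore] -/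
theorem contDiffAt_lagrangianCurrent {G : E4 → Fin 4 → Fin 4 → ℝ} {ϖ w : E4 → ℝ} {x : E4}
    (hG : ∀ μ ν, ContDiffAt ℝ 1 (fun y ↦ G y μ ν) x) (hϖ : ContDiffAt ℝ 2 ϖ x)
    (hw : ContDiffAt ℝ 2 w x) (μ : Fin 4) :
    ContDiffAt ℝ 1 (fun y ↦ lagrangianCurrent G ϖ w y μ) x := by
  have hp : ∀ κ, ContDiffAt ℝ 1 (fun y ↦ fderiv ℝ w y (E4.basisVector κ)) x := fun κ ↦
    (hw.fderiv_right (m := 1) le_rfl).clm_apply contDiffAt_const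
  have hq : ∀ κ, ContDiffAt ℝ 1 (fun y ↦ fderiv ℝ ϖ y (E4.basisVector κ)) x := fun κ ↦
    (hϖ.fderiv_right (m := 1) le_rfl).clm_apply contDiffAt_const
  have hw1 : ContDiffAt ℝ 1 w x := hw.of_le one_le_two
  have hϖ1 : ContDiffAt ℝ 1 ϖ x := hϖ.of_le one_le_two
  unfold lagrangianCurrent
  exact ((hϖ1.mul hw1).mul (ContDiffAt.sum fun ν _ ↦ (hG μ ν).mul (hp ν))).sub
    ((contDiffAt_const.mul (hw1.pow 2)).mul (ContDiffAt.sum fun ν _ ↦ (hG μ ν).mul (hq ν)))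

/-! ### The energy identity for a cut-off modified current with a smeared time cut-off -/

/-- **The energy identity for the cut-off modified current `f (J^X + ¼ L_ϖ)` between two leaves
`{t = τ + F}`, `{t = τ + h + F}` of a graph foliation, with a smeared future time cut-off and local
regularity** (DRSR arXiv:1402.7034, §2.3.1–§2.3.2 with Remark 2.3.1, on the regions
`𝓡(τ₁, τ₂) ∩ {t ≤ T*}` of Moschidis arXiv:1509.08489, §4–§5, in the Kerr–Schild chart). Data: a
cut-off `f ∈ C¹(ℝ⁴)` with `tsupport f ⊆ U`; on `U` a symmetric coefficient field `G` and a
multiplier `X` of class `C¹` and a weight `ϖ` and a function `w` of class `C²` (all four arbitrary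
off `U`); a profile `ζ ∈ C¹(ℝ)` vanishing on `(−∞, 0]`; a `C²` height `F`, `h ≥ 0`, `τ`, `T`; and
the support condition: at every point `x` of the closed wedge `τ + F ≤ x⁰ ≤ τ + h + F` with
`‖x⃗‖ > ρ` and `x⁰ < T`, either `f(x) = 0` or `w(x) = 0 ∧ dw(x) = 0`. Then, writing `𝒥 = J^X + ¼ L_ϖ`
(`KerrSchild.multiplierCurrent`, `KerrSchild.lagrangianCurrent`), `n = dt − dF`,
`∫ ζ(T − τ − h − F) f ∑_μ 𝒥^μ n_μ |_{(τ + h + F(y), y)} dy − ∫ ζ(T − τ − F) f ∑_μ 𝒥^μ n_μ |_{(τ + F(y), y)} dy =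
 ∫ ∫_{(τ + F(y), τ + h + F(y)]} { ζ(T − t) ( f [ (X(w) + ¼ϖw) □_G w + (K^X + ¼ϖQ − ⅛(□_G ϖ) w²) ]
   + ∑_μ 𝒥^μ ∂_μ f ) − ζ'(T − t) f 𝒥⁰ } (t, y) dt dy`
with `X(w) = ∑_α X^α ∂_αw`, `Q = ∑ G^{αβ}∂_αw∂_βw`, `K^X = KerrSchild.multiplierBulk`,
`□_G = KerrSchild.waveOperator`: bulk `K^{X,ϖ}`, source `𝓔^{X,ϖ}`-term, cut-off error `𝒥(df)`, and
the smeared flux `−ζ' f 𝒥⁰` through the slices near `{t = T}`. Proof: the current `f 𝒥` is `C¹` on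
`ℝ⁴` (`E4.contDiff_mul_of_tsupport_subset`), `E4.graphFlux_translate_sub_eq_integral_integral_timeCutoff`
applies to it, and its divergence is `f ∑∂_μ𝒥^μ + ∑ 𝒥^μ ∂_μ f` everywhere
(`E4.fderiv_mul_of_tsupport_subset`) with `∑ ∂_μ 𝒥^μ` given on `U` by
`KerrSchild.sum_fderiv_modifiedCurrent` (off `tsupport f` the factor `f` kills the junk).
[cite: DafermosRodnianskiShlapentokhrothman2014, §2.3.1–§2.3.2 and Remark 2.3.1; Moschidis2016 §5 Thm. 5.1] -/
theorem cutoffModifiedCurrent_graph_identity_timeCutoff {G : E4 → Fin 4 → Fin 4 → ℝ}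
    {X : E4 → Fin 4 → ℝ} {ϖ w f : E4 → ℝ} {U : Set E4} (hfU : tsupport f ⊆ U)
    (hf : ContDiff ℝ 1 f) (hG : ∀ x ∈ U, ∀ μ ν, ContDiffAt ℝ 1 (fun y ↦ G y μ ν) x)
    (hsymm : ∀ x ∈ U, ∀ μ ν, G x μ ν = G x ν μ)
    (hX : ∀ x ∈ U, ∀ α, ContDiffAt ℝ 1 (fun y ↦ X y α) x) (hϖ : ∀ x ∈ U, ContDiffAt ℝ 2 ϖ x)
    (hw : ∀ x ∈ U, ContDiffAt ℝ 2 w x) {ζ : ℝ → ℝ} (hζ : ContDiff ℝ 1 ζ)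
    (hζ0 : ∀ s ≤ 0, ζ s = 0) {F : E3 → ℝ} (hF : ContDiff ℝ 2 F) {τ h T ρ : ℝ} (hh : 0 ≤ h)
    (hfar : ∀ x : E4, ρ < E4.spatialNorm x → τ + F (E4.spatial x) ≤ x 0 →
      x 0 ≤ τ + h + F (E4.spatial x) → x 0 < T → f x = 0 ∨ (w x = 0 ∧ fderiv ℝ w x = 0)) :
    (∫ y, ζ (T - (τ + h + F y)) * (f (E4.ofTimeSpace (τ + h + F y) y) *
        ∑ μ, (multiplierCurrent G X w (E4.ofTimeSpace (τ + h + F y) y) μ +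
          4⁻¹ * lagrangianCurrent G ϖ w (E4.ofTimeSpace (τ + h + F y) y) μ) *
            Kerr.graphConormal F y μ)) -
        ∫ y, ζ (T - (τ + F y)) * (f (E4.ofTimeSpace (τ + F y) y) *
          ∑ μ, (multiplierCurrent G X w (E4.ofTimeSpace (τ + F y) y) μ +
            4⁻¹ * lagrangianCurrent G ϖ w (E4.ofTimeSpace (τ + F y) y) μ) *
              Kerr.graphConormal F y μ) =
      ∫ y, ∫ t in Set.Ioc (τ + F y) (τ + h + F y),
        (ζ (T - t) *
            (f (E4.ofTimeSpace t y) *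
                (((∑ α, X (E4.ofTimeSpace t y) α *
                      fderiv ℝ w (E4.ofTimeSpace t y) (E4.basisVector α)) +
                    4⁻¹ * (ϖ (E4.ofTimeSpace t y) * w (E4.ofTimeSpace t y))) *
                  waveOperator G w (E4.ofTimeSpace t y) +
                (multiplierBulk G X w (E4.ofTimeSpace t y) +
                  4⁻¹ * (ϖ (E4.ofTimeSpace t y) * ∑ α, ∑ β, G (E4.ofTimeSpace t y) α β *
                    fderiv ℝ w (E4.ofTimeSpace t y) (E4.basisVector α) *
                      fderiv ℝ w (E4.ofTimeSpace t y) (E4.basisVector β)) -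
                  8⁻¹ * waveOperator G ϖ (E4.ofTimeSpace t y) * w (E4.ofTimeSpace t y) ^ 2)) +
              ∑ μ, (multiplierCurrent G X w (E4.ofTimeSpace t y) μ +
                  4⁻¹ * lagrangianCurrent G ϖ w (E4.ofTimeSpace t y) μ) *
                fderiv ℝ f (E4.ofTimeSpace t y) (E4.basisVector μ)) -
          deriv ζ (T - t) * (f (E4.ofTimeSpace t y) *
            (multiplierCurrent G X w (E4.ofTimeSpace t y) 0 +
              4⁻¹ * lagrangianCurrent G ϖ w (E4.ofTimeSpace t y) 0))) := by
  -- the modified current `𝒥 = J^X + ¼ L` and the cut-off current `f 𝒥`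
  obtain ⟨𝒥, h𝒥⟩ : ∃ 𝒥 : Fin 4 → E4 → ℝ, ∀ μ x,
      𝒥 μ x = multiplierCurrent G X w x μ + 4⁻¹ * lagrangianCurrent G ϖ w x μ :=
    ⟨_, fun _ _ ↦ rfl⟩
  have h𝒥fun : ∀ μ, 𝒥 μ = fun x ↦ multiplierCurrent G X w x μ + 4⁻¹ * lagrangianCurrent G ϖ w x μ :=
    fun μ ↦ funext (h𝒥 μ)
  have h𝒥U : ∀ x ∈ U, ∀ μ, ContDiffAt ℝ 1 (𝒥 μ) x := fun x hx μ ↦ by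
    rw [h𝒥fun]
    exact (contDiffAt_multiplierCurrent (hG x hx) (hX x hx) (hw x hx) μ).add
      (contDiffAt_const.mul (contDiffAt_lagrangianCurrent (hG x hx) (hϖ x hx) (hw x hx) μ))
  have hJ1 : ∀ μ, ContDiff ℝ 1 fun x ↦ f x * 𝒥 μ x := fun μ ↦
    E4.contDiff_mul_of_tsupport_subset hfU hf fun x hx ↦ h𝒥U x hx μ
  -- support below the time level `T`
  have hJ0 : ∀ μ (x : E4), ρ < E4.spatialNorm x → τ + F (E4.spatial x) ≤ x 0 →
      x 0 ≤ τ + h + F (E4.spatial x) → x 0 < T → f x * 𝒥 μ x = 0 := by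
    intro μ x hx h1 h2 hT
    rcases hfar x hx h1 h2 hT with h0 | ⟨hw0, hdw0⟩
    · rw [h0, zero_mul]
    · rw [h𝒥, multiplierCurrent_eq_zero_of_fderiv_eq_zero G X hdw0,
        lagrangianCurrent_eq_zero_of_eq_zero G ϖ hw0, mul_zero, add_zero, mul_zero]
  -- the identity for the current `f 𝒥` between the leaves `Σ_τ`, `Σ_{τ+h}`
  have hmain := E4.graphFlux_translate_sub_eq_integral_integral_timeCutoff
    (J := fun μ x ↦ f x * 𝒥 μ x) hJ1 hζ hζ0 hF hh (τ := τ) (T := T) (ρ := ρ) hJ0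
  have hflux : ∀ (y : E3) (t : ℝ),
      ∑ μ, f (E4.ofTimeSpace t y) * 𝒥 μ (E4.ofTimeSpace t y) * Kerr.graphConormal F y μ =
        f (E4.ofTimeSpace t y) * ∑ μ, (multiplierCurrent G X w (E4.ofTimeSpace t y) μ +
          4⁻¹ * lagrangianCurrent G ϖ w (E4.ofTimeSpace t y) μ) * Kerr.graphConormal F y μ := by
    intro y t
    rw [Finset.mul_sum]
    exact Finset.sum_congr rfl fun μ _ ↦ by rw [h𝒥]; ring
  simp only [hflux] at hmain
  rw [hmain]
  -- the divergence of `f 𝒥`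
  refine congrArg (fun g : E3 → ℝ ↦ ∫ y, g y) (funext fun y ↦ ?_)
  refine setIntegral_congr_fun measurableSet_Ioc fun t _ ↦ ?_
  have hprod : ∀ μ, fderiv ℝ (fun x ↦ f x * 𝒥 μ x) (E4.ofTimeSpace t y) (E4.basisVector μ) =
      f (E4.ofTimeSpace t y) * fderiv ℝ (𝒥 μ) (E4.ofTimeSpace t y) (E4.basisVector μ) +
        𝒥 μ (E4.ofTimeSpace t y) * fderiv ℝ f (E4.ofTimeSpace t y) (E4.basisVector μ) :=
    fun μ ↦ E4.fderiv_mul_of_tsupport_subset hfU hf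
      (fun x hx ↦ (h𝒥U x hx μ).differentiableAt one_ne_zero) _ _
  have hdiv : f (E4.ofTimeSpace t y) * ∑ μ, fderiv ℝ (𝒥 μ) (E4.ofTimeSpace t y) (E4.basisVector μ) =
      f (E4.ofTimeSpace t y) *
        (((∑ α, X (E4.ofTimeSpace t y) α *
              fderiv ℝ w (E4.ofTimeSpace t y) (E4.basisVector α)) +
            4⁻¹ * (ϖ (E4.ofTimeSpace t y) * w (E4.ofTimeSpace t y))) *
          waveOperator G w (E4.ofTimeSpace t y) +
        (multiplierBulk G X w (E4.ofTimeSpace t y) +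
          4⁻¹ * (ϖ (E4.ofTimeSpace t y) * ∑ α, ∑ β, G (E4.ofTimeSpace t y) α β *
            fderiv ℝ w (E4.ofTimeSpace t y) (E4.basisVector α) *
              fderiv ℝ w (E4.ofTimeSpace t y) (E4.basisVector β)) -
          8⁻¹ * waveOperator G ϖ (E4.ofTimeSpace t y) * w (E4.ofTimeSpace t y) ^ 2)) := by
    by_cases hx : E4.ofTimeSpace t y ∈ U
    · simp only [h𝒥fun]
      rw [sum_fderiv_modifiedCurrent
        (fun μ ν ↦ (hG _ hx μ ν).differentiableAt one_ne_zero) (hsymm _ hx)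
        (fun α ↦ (hX _ hx α).differentiableAt one_ne_zero) (hϖ _ hx) (hw _ hx)]
    · have hx' : E4.ofTimeSpace t y ∉ tsupport f := fun h' ↦ hx (hfU h')
      rw [image_eq_zero_of_notMem_tsupport hx', zero_mul, zero_mul]
  simp only [hprod, Finset.sum_add_distrib, ← Finset.mul_sum, hdiv]
  simp only [h𝒥]


/-- **The same identity between two graph hypersurfaces of different heights `F₁ ≤ F₂`** (e.g. the
Kerr–Schild slice `{t = τ}`, `F₁ = 0`, on which the data of an admissible wave are compactly
supported, and a hyperboloidal leaf `{t = τ + F₂}` above it): for the cut-off modified current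
`f (J^X + ¼ L_ϖ)` under local regularity near `tsupport f`, a profile `ζ ∈ C¹(ℝ)` vanishing on
`(−∞, 0]`, `C²` heights `F₁ ≤ F₂`, and the support condition below the time level `T` on the wedge
`{τ + F₁ ≤ x⁰ ≤ τ + F₂}`,
`∫ ζ(T − τ − F₂) f ∑_μ 𝒥^μ n^{F₂}_μ |_{(τ + F₂(y), y)} dy − ∫ ζ(T − τ − F₁) f ∑_μ 𝒥^μ n^{F₁}_μ |_{(τ + F₁(y), y)} dy`
equals the space-time integral over `(τ + F₁(y), τ + F₂(y)]` of the same integrand as in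
`cutoffModifiedCurrent_graph_identity_timeCutoff` (DRSR arXiv:1402.7034, §2.3.2, (ingeneralform)
between two admissible hypersurfaces, with the smeared future boundary of this file).
[cite: DafermosRodnianskiShlapentokhrothman2014, §2.3.1–§2.3.2 and Remark 2.3.1; Moschidis2016 §5 Thm. 5.1] -/
theorem cutoffModifiedCurrent_graphs_identity_timeCutoff {G : E4 → Fin 4 → Fin 4 → ℝ}
    {X : E4 → Fin 4 → ℝ} {ϖ w f : E4 → ℝ} {U : Set E4} (hfU : tsupport f ⊆ U)
    (hf : ContDiff ℝ 1 f) (hG : ∀ x ∈ U, ∀ μ ν, ContDiffAt ℝ 1 (fun y ↦ G y μ ν) x)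
    (hsymm : ∀ x ∈ U, ∀ μ ν, G x μ ν = G x ν μ)
    (hX : ∀ x ∈ U, ∀ α, ContDiffAt ℝ 1 (fun y ↦ X y α) x) (hϖ : ∀ x ∈ U, ContDiffAt ℝ 2 ϖ x)
    (hw : ∀ x ∈ U, ContDiffAt ℝ 2 w x) {ζ : ℝ → ℝ} (hζ : ContDiff ℝ 1 ζ)
    (hζ0 : ∀ s ≤ 0, ζ s = 0) {F₁ F₂ : E3 → ℝ} (hF₁ : ContDiff ℝ 2 F₁) (hF₂ : ContDiff ℝ 2 F₂)
    (hle : ∀ y, F₁ y ≤ F₂ y) {τ T ρ : ℝ}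
    (hfar : ∀ x : E4, ρ < E4.spatialNorm x → τ + F₁ (E4.spatial x) ≤ x 0 →
      x 0 ≤ τ + F₂ (E4.spatial x) → x 0 < T → f x = 0 ∨ (w x = 0 ∧ fderiv ℝ w x = 0)) :
    (∫ y, ζ (T - (τ + F₂ y)) * (f (E4.ofTimeSpace (τ + F₂ y) y) *
        ∑ μ, (multiplierCurrent G X w (E4.ofTimeSpace (τ + F₂ y) y) μ +
          4⁻¹ * lagrangianCurrent G ϖ w (E4.ofTimeSpace (τ + F₂ y) y) μ) *
            Kerr.graphConormal F₂ y μ)) -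
        ∫ y, ζ (T - (τ + F₁ y)) * (f (E4.ofTimeSpace (τ + F₁ y) y) *
          ∑ μ, (multiplierCurrent G X w (E4.ofTimeSpace (τ + F₁ y) y) μ +
            4⁻¹ * lagrangianCurrent G ϖ w (E4.ofTimeSpace (τ + F₁ y) y) μ) *
              Kerr.graphConormal F₁ y μ) =
      ∫ y, ∫ t in Set.Ioc (τ + F₁ y) (τ + F₂ y),
        (ζ (T - t) *
            (f (E4.ofTimeSpace t y) *
                (((∑ α, X (E4.ofTimeSpace t y) α *
                      fderiv ℝ w (E4.ofTimeSpace t y) (E4.basisVector α)) +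
                    4⁻¹ * (ϖ (E4.ofTimeSpace t y) * w (E4.ofTimeSpace t y))) *
                  waveOperator G w (E4.ofTimeSpace t y) +
                (multiplierBulk G X w (E4.ofTimeSpace t y) +
                  4⁻¹ * (ϖ (E4.ofTimeSpace t y) * ∑ α, ∑ β, G (E4.ofTimeSpace t y) α β *
                    fderiv ℝ w (E4.ofTimeSpace t y) (E4.basisVector α) *
                      fderiv ℝ w (E4.ofTimeSpace t y) (E4.basisVector β)) -
                  8⁻¹ * waveOperator G ϖ (E4.ofTimeSpace t y) * w (E4.ofTimeSpace t y) ^ 2)) +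
              ∑ μ, (multiplierCurrent G X w (E4.ofTimeSpace t y) μ +
                  4⁻¹ * lagrangianCurrent G ϖ w (E4.ofTimeSpace t y) μ) *
                fderiv ℝ f (E4.ofTimeSpace t y) (E4.basisVector μ)) -
          deriv ζ (T - t) * (f (E4.ofTimeSpace t y) *
            (multiplierCurrent G X w (E4.ofTimeSpace t y) 0 +
              4⁻¹ * lagrangianCurrent G ϖ w (E4.ofTimeSpace t y) 0))) := by
  -- the modified current `𝒥 = J^X + ¼ L` and the cut-off current `f 𝒥`
  obtain ⟨𝒥, h𝒥⟩ : ∃ 𝒥 : Fin 4 → E4 → ℝ, ∀ μ x,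
      𝒥 μ x = multiplierCurrent G X w x μ + 4⁻¹ * lagrangianCurrent G ϖ w x μ :=
    ⟨_, fun _ _ ↦ rfl⟩
  have h𝒥fun : ∀ μ, 𝒥 μ = fun x ↦ multiplierCurrent G X w x μ + 4⁻¹ * lagrangianCurrent G ϖ w x μ :=
    fun μ ↦ funext (h𝒥 μ)
  have h𝒥U : ∀ x ∈ U, ∀ μ, ContDiffAt ℝ 1 (𝒥 μ) x := fun x hx μ ↦ by
    rw [h𝒥fun]
    exact (contDiffAt_multiplierCurrent (hG x hx) (hX x hx) (hw x hx) μ).add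
      (contDiffAt_const.mul (contDiffAt_lagrangianCurrent (hG x hx) (hϖ x hx) (hw x hx) μ))
  have hJ1 : ∀ μ, ContDiff ℝ 1 fun x ↦ f x * 𝒥 μ x := fun μ ↦
    E4.contDiff_mul_of_tsupport_subset hfU hf fun x hx ↦ h𝒥U x hx μ
  -- support below the time level `T`
  have hJ0 : ∀ μ (x : E4), ρ < E4.spatialNorm x → τ + F₁ (E4.spatial x) ≤ x 0 →
      x 0 ≤ τ + F₂ (E4.spatial x) → x 0 < T → f x * 𝒥 μ x = 0 := by
    intro μ x hx h1 h2 hT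
    rcases hfar x hx h1 h2 hT with h0 | ⟨hw0, hdw0⟩
    · rw [h0, zero_mul]
    · rw [h𝒥, multiplierCurrent_eq_zero_of_fderiv_eq_zero G X hdw0,
        lagrangianCurrent_eq_zero_of_eq_zero G ϖ hw0, mul_zero, add_zero, mul_zero]
  -- the identity for the current `f 𝒥` between the two graphs
  have hmain := E4.graphFlux_sub_eq_integral_integral_timeCutoff
    (J := fun μ x ↦ f x * 𝒥 μ x) hJ1 hζ hζ0 hF₁ hF₂ hle (τ := τ) (T := T) (ρ := ρ) hJ0
  have hflux : ∀ (F : E3 → ℝ) (y : E3) (t : ℝ),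
      ∑ μ, f (E4.ofTimeSpace t y) * 𝒥 μ (E4.ofTimeSpace t y) * Kerr.graphConormal F y μ =
        f (E4.ofTimeSpace t y) * ∑ μ, (multiplierCurrent G X w (E4.ofTimeSpace t y) μ +
          4⁻¹ * lagrangianCurrent G ϖ w (E4.ofTimeSpace t y) μ) * Kerr.graphConormal F y μ := by
    intro F y t
    rw [Finset.mul_sum]
    exact Finset.sum_congr rfl fun μ _ ↦ by rw [h𝒥]; ring
  simp only [hflux] at hmain
  rw [hmain]
  -- the divergence of `f 𝒥`
  refine congrArg (fun g : E3 → ℝ ↦ ∫ y, g y) (funext fun y ↦ ?_)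
  refine setIntegral_congr_fun measurableSet_Ioc fun t _ ↦ ?_
  have hprod : ∀ μ, fderiv ℝ (fun x ↦ f x * 𝒥 μ x) (E4.ofTimeSpace t y) (E4.basisVector μ) =
      f (E4.ofTimeSpace t y) * fderiv ℝ (𝒥 μ) (E4.ofTimeSpace t y) (E4.basisVector μ) +
        𝒥 μ (E4.ofTimeSpace t y) * fderiv ℝ f (E4.ofTimeSpace t y) (E4.basisVector μ) :=
    fun μ ↦ E4.fderiv_mul_of_tsupport_subset hfU hf
      (fun x hx ↦ (h𝒥U x hx μ).differentiableAt one_ne_zero) _ _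
  have hdiv : f (E4.ofTimeSpace t y) * ∑ μ, fderiv ℝ (𝒥 μ) (E4.ofTimeSpace t y) (E4.basisVector μ) =
      f (E4.ofTimeSpace t y) *
        (((∑ α, X (E4.ofTimeSpace t y) α *
              fderiv ℝ w (E4.ofTimeSpace t y) (E4.basisVector α)) +
            4⁻¹ * (ϖ (E4.ofTimeSpace t y) * w (E4.ofTimeSpace t y))) *
          waveOperator G w (E4.ofTimeSpace t y) +
        (multiplierBulk G X w (E4.ofTimeSpace t y) +
          4⁻¹ * (ϖ (E4.ofTimeSpace t y) * ∑ α, ∑ β, G (E4.ofTimeSpace t y) α β *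
            fderiv ℝ w (E4.ofTimeSpace t y) (E4.basisVector α) *
              fderiv ℝ w (E4.ofTimeSpace t y) (E4.basisVector β)) -
          8⁻¹ * waveOperator G ϖ (E4.ofTimeSpace t y) * w (E4.ofTimeSpace t y) ^ 2)) := by
    by_cases hx : E4.ofTimeSpace t y ∈ U
    · simp only [h𝒥fun]
      rw [sum_fderiv_modifiedCurrent
        (fun μ ν ↦ (hG _ hx μ ν).differentiableAt one_ne_zero) (hsymm _ hx)
        (fun α ↦ (hX _ hx α).differentiableAt one_ne_zero) (hϖ _ hx) (hw _ hx)]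
    · have hx' : E4.ofTimeSpace t y ∉ tsupport f := fun h' ↦ hx (hfU h')
      rw [image_eq_zero_of_notMem_tsupport hx', zero_mul, zero_mul]
  simp only [hprod, Finset.sum_add_distrib, ← Finset.mul_sum, hdiv]
  simp only [h𝒥]

end KerrSchild

namespace E4

/-! ### Slicing the space-time integrals in time -/

/-- **Slicing a space-time integral over the region between two graphs, in time** (Fubini). For a
continuous integrand `Φ` on `ℝ × E3`, continuous `a, b : E3 → ℝ`, such that `Φ` vanishes at the
points of the wedge `{a(y) < t ≤ b(y)}` outside a bounded set `[t₀, t₁] × B̄_ρ`,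
`∫ ( ∫_{t ∈ (a(y), b(y)]} Φ(t, y) dt ) dy = ∫ ( ∫_{{y : a(y) < t ≤ b(y)}} Φ(t, y) dy ) dt`.
In this form the layer term `∫∫ ζ'(T − t)(−J⁰)` of the identities above is the `ζ'`-average over
`t` of the energies of `J` through the pieces `{y : τ + F₁(y) < t ≤ τ + F₂(y)}` of the slices
`{t = const}` — the terms on `{t = T*} ∩ 𝓡(τ₁, τ₂)` of Moschidis (arXiv:1509.08489, Thm. 5.1,
Lemmas 4.1, 4.5), to which slice-wise estimates apply. [folklore] -/
theorem integral_integral_Ioc_eq_integral_setIntegral {Φ : ℝ → E3 → ℝ}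
    (hΦ : Continuous (Function.uncurry Φ)) {a b : E3 → ℝ} (ha : Continuous a)
    (hb : Continuous b) {t₀ t₁ ρ : ℝ}
    (hsupp : ∀ t y, a y < t → t ≤ b y → Φ t y ≠ 0 → t ∈ Set.Icc t₀ t₁ ∧ ‖y‖ ≤ ρ) :
    ∫ y, ∫ t in Set.Ioc (a y) (b y), Φ t y = ∫ t, ∫ y in {y | a y < t ∧ t ≤ b y}, Φ t y := by
  -- the wedge and the truncated integrand on `ℝ × E3`
  set W : Set (ℝ × E3) := {p | a p.2 < p.1 ∧ p.1 ≤ b p.2} with hW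
  have hWm : MeasurableSet W :=
    (measurableSet_lt (ha.measurable.comp measurable_snd) measurable_fst).inter
      (measurableSet_le measurable_fst (hb.measurable.comp measurable_snd))
  set Ψ : ℝ × E3 → ℝ := W.indicator (Function.uncurry Φ) with hΨ
  -- `Ψ` is integrable: supported in a compact set on which `Φ` is integrable
  have hK : IsCompact (Set.Icc t₀ t₁ ×ˢ closedBall (0 : E3) ρ) :=
    isCompact_Icc.prod (isCompact_closedBall _ _)
  have hΨsupp : Function.support Ψ ⊆ Set.Icc t₀ t₁ ×ˢ closedBall (0 : E3) ρ := by
    intro p hp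
    rw [Function.mem_support] at hp
    have hpW : p ∈ W := by
      by_contra h
      exact hp (Set.indicator_of_notMem h _)
    rw [hΨ, Set.indicator_of_mem hpW] at hp
    obtain ⟨ht, hy⟩ := hsupp p.1 p.2 hpW.1 hpW.2 hp
    exact ⟨ht, by simpa using hy⟩
  have hΨint : Integrable Ψ ((volume : Measure ℝ).prod (volume : Measure E3)) := by
    rw [← Measure.volume_eq_prod, ← integrableOn_iff_integrable_of_support_subset hΨsupp]
    exact (hΦ.continuousOn.integrableOn_compact hK).indicator hWm
  have hΨint' : Integrable (Function.uncurry fun (y : E3) (t : ℝ) ↦ Ψ (t, y))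
      ((volume : Measure E3).prod (volume : Measure ℝ)) := hΨint.swap
  -- the two iterated integrals of `Ψ`
  have hy : ∀ y, ∫ t in Set.Ioc (a y) (b y), Φ t y = ∫ t, Ψ (t, y) := by
    intro y
    rw [← integral_indicator measurableSet_Ioc]
    refine integral_congr_ae (Filter.Eventually.of_forall fun t ↦ ?_)
    change _ = W.indicator (Function.uncurry Φ) (t, y)
    by_cases ht : t ∈ Set.Ioc (a y) (b y)
    · rw [Set.indicator_of_mem ht, Set.indicator_of_mem (show (t, y) ∈ W from ht)]
      rfl
    · rw [Set.indicator_of_notMem ht, Set.indicator_of_notMem (show (t, y) ∉ W from ht)]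
  have ht : ∀ t, ∫ y in {y | a y < t ∧ t ≤ b y}, Φ t y = ∫ y, Ψ (t, y) := by
    intro t
    have hm : MeasurableSet {y | a y < t ∧ t ≤ b y} :=
      (measurableSet_lt ha.measurable measurable_const).inter
        (measurableSet_le measurable_const hb.measurable)
    rw [← integral_indicator hm]
    refine integral_congr_ae (Filter.Eventually.of_forall fun y ↦ ?_)
    change _ = W.indicator (Function.uncurry Φ) (t, y)
    by_cases hy' : y ∈ {y | a y < t ∧ t ≤ b y}
    · rw [Set.indicator_of_mem hy', Set.indicator_of_mem (show (t, y) ∈ W from hy')]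
      rfl
    · rw [Set.indicator_of_notMem hy', Set.indicator_of_notMem (show (t, y) ∉ W from hy')]
  simp only [hy, ht]
  exact integral_integral_swap hΨint'

/-! ### Removing the time cut-off: `T → ∞` -/

/-- **Removal of the smeared time cut-off (monotone convergence).** Let `ζ : ℝ → ℝ` be
non-decreasing with `ζ ≤ 1` and `ζ = 1` on `[1, ∞)` (e.g. `Real.smoothTransition`), `θ` a measurable
real function ("time") on a measure space and `e ≥ 0` an a.e.-measurable density. Then
`∫⁻ ζ(T − θ(x)) e(x) dμ(x) → ∫⁻ e dμ` as `T → ∞` (in `[0, ∞]`; the cut-off integrals increase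
with `T` and each point is eventually uncovered). Applied with `θ(y) = τ + F(y)` on `E3` this
removes the cut-off from the flux through a leaf `{t = τ + F}`; applied on space-time it removes it
from a non-negative bulk term — the passage `T* → +∞` in Moschidis (arXiv:1509.08489, Thm. 5.1) and
the definition of the terms on `𝓘⁺` as limits in Dafermos–Rodnianski (arXiv:0910.4957, §3).
[folklore] -/
theorem tendsto_lintegral_timeCutoff {α : Type*} [MeasurableSpace α] {μ : Measure α}
    {ζ : ℝ → ℝ} (hζm : Monotone ζ) (hζle : ∀ s, ζ s ≤ 1) (hζ1 : ∀ s, 1 ≤ s → ζ s = 1)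
    {θ : α → ℝ} (hθ : Measurable θ) {e : α → ℝ≥0∞} (he : AEMeasurable e μ) :
    Tendsto (fun T : ℝ ↦ ∫⁻ x, ENNReal.ofReal (ζ (T - θ x)) * e x ∂μ) atTop
      (𝓝 (∫⁻ x, e x ∂μ)) := by
  -- the cut-off integrals are monotone in `T` and bounded by the full integral
  have hle : ∀ T, ∫⁻ x, ENNReal.ofReal (ζ (T - θ x)) * e x ∂μ ≤ ∫⁻ x, e x ∂μ := fun T ↦
    lintegral_mono fun x ↦ by
      calc ENNReal.ofReal (ζ (T - θ x)) * e x ≤ 1 * e x := by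
            gcongr
            exact ENNReal.ofReal_le_one.2 (hζle _)
        _ = e x := one_mul _
  have hmono : Monotone fun T : ℝ ↦ ∫⁻ x, ENNReal.ofReal (ζ (T - θ x)) * e x ∂μ :=
    fun T T' hTT' ↦ lintegral_mono fun x ↦ by
      gcongr
      exact hζm (by linarith)
  -- along the integers: monotone convergence
  have hnat : Tendsto (fun n : ℕ ↦ ∫⁻ x, ENNReal.ofReal (ζ ((n : ℝ) - θ x)) * e x ∂μ) atTop
      (𝓝 (∫⁻ x, e x ∂μ)) := by
    refine lintegral_tendsto_of_tendsto_of_monotone (fun n ↦ ?_)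
      (Filter.Eventually.of_forall fun x n m hnm ↦ ?_) (Filter.Eventually.of_forall fun x ↦ ?_)
    · have hζmeas : Measurable ζ := hζm.measurable
      exact ((hζmeas.comp (measurable_const.sub hθ)).ennreal_ofReal.aemeasurable).mul he
    · dsimp only
      gcongr
      exact hζm (by simpa using hnm)
    · -- eventually constant, equal to `e x`
      refine tendsto_atTop_of_eventually_const (i₀ := ⌈θ x + 1⌉₊) fun n hn ↦ ?_
      have hn' : θ x + 1 ≤ n := (Nat.le_ceil _).trans (by exact_mod_cast hn)
      rw [hζ1 _ (by linarith), ENNReal.ofReal_one, one_mul]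
  -- along the reals, by monotonicity
  refine tendsto_order.2 ⟨fun b hb ↦ ?_, fun b hb ↦ Filter.Eventually.of_forall fun T ↦
    (hle T).trans_lt hb⟩
  obtain ⟨n, hn⟩ := (hnat.eventually (lt_mem_nhds hb)).exists
  filter_upwards [eventually_ge_atTop (n : ℝ)] with T hT
  exact hn.trans_le (hmono hT)

/-- The cut-off integrals never exceed the full integral (`ζ ≤ 1`): the monotone limit of
`tendsto_lintegral_timeCutoff` is approached from below, so an upper bound for all cut-off
integrals is an upper bound for the full one and conversely. [folklore] -/
theorem lintegral_timeCutoff_le {α : Type*} [MeasurableSpace α] {μ : Measure α}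
    {ζ : ℝ → ℝ} (hζle : ∀ s, ζ s ≤ 1) (θ : α → ℝ) (e : α → ℝ≥0∞) (T : ℝ) :
    ∫⁻ x, ENNReal.ofReal (ζ (T - θ x)) * e x ∂μ ≤ ∫⁻ x, e x ∂μ :=
  lintegral_mono fun x ↦ by
    calc ENNReal.ofReal (ζ (T - θ x)) * e x ≤ 1 * e x := by
          gcongr
          exact ENNReal.ofReal_le_one.2 (hζle _)
      _ = e x := one_mul _

/-- **Upper bounds pass to the limit**: if every cut-off integral is bounded by `C`, so is the full
integral (`le_of_tendsto` and `tendsto_lintegral_timeCutoff`). This is the form in which an energy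
inequality on the truncated regions `{t ≤ T}` (with the smeared flux through `{t = T}` dropped by
its sign) yields the inequality on the full region reaching `𝓘⁺`. [folklore] -/
theorem lintegral_le_of_forall_lintegral_timeCutoff_le {α : Type*} [MeasurableSpace α]
    {μ : Measure α} {ζ : ℝ → ℝ} (hζm : Monotone ζ) (hζle : ∀ s, ζ s ≤ 1)
    (hζ1 : ∀ s, 1 ≤ s → ζ s = 1) {θ : α → ℝ} (hθ : Measurable θ) {e : α → ℝ≥0∞}
    (he : AEMeasurable e μ) {C : ℝ≥0∞} {T₀ : ℝ}
    (hC : ∀ T, T₀ ≤ T → ∫⁻ x, ENNReal.ofReal (ζ (T - θ x)) * e x ∂μ ≤ C) :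
    ∫⁻ x, e x ∂μ ≤ C :=
  le_of_tendsto (tendsto_lintegral_timeCutoff hζm hζle hζ1 hθ he)
    (eventually_atTop.2 ⟨T₀, fun T hT ↦ hC T hT⟩)

end E4

end Literature.Geometry.Lorentzian
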